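import Mathlib
import Summits.Ventures.HodgeRepro.Tier4.Target
import Summits.Ventures.HodgeRepro.Tier4.Common.TargetData
import Summits.Ventures.HodgeRepro.Tier4.Common.AutForms
import Summits.Ventures.HodgeRepro.Tier4.Common.CornerForms
import Summits.Ventures.HodgeRepro.Tier4.Common.HeckeOnForms
import Summits.Ventures.HodgeRepro.Tier4.Common.HeckeInvariance
import Summits.Ventures.HodgeRepro.Tier4.Line4.MixedTransfer

/-!
# Tier4/Line4/MixedInvariant — L4.1: the mixed `(1,1)`-forms of LINE L4 are `Γ′`-invariant

Blind re-derivation cell `pub-hodge-repro`, Tier 4 «prove the step» (README §9–§10), seat t4-L4-p1 (prover, LINE L4,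
gen 0; lead's assignment S12095).  Tree path `lean/Summits/Ventures/HodgeRepro/Tier4/Line4/MixedInvariant.lean`.
Paper proof: `proofs/t4/L4/MixedInvariant.md`.

WHAT IS PROVED.  The registered lemma L4.1 of the skeleton `Tier4/Line4/Skeleton.lean` v0.2 (L308–L316):
`mixed_invariant : d.IsLevel Γ' → d.IsHeckeFor Γ' h → IsInvariant11 d Γ' (ξ₁₃ d h) ∧ IsInvariant11 d Γ' (ξ₂₄ d h)`
— for every level `Γ′ ≤ Γ`, every family `h` of Hecke elements of level `Γ′`, every `γ ∈ Γ′` and every `z` of the ball,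
`pull (d.act γ) ξ z = ξ z` for the two mixed forms `ξ₁₃(h) = du₁ ∧ conj du₃`, `ξ₂₄(h) = du₂ ∧ conj du₄`.  The DEFINED
objects `jacMat`, `pull`, `IsInvariant11` are restated here BYTE-IDENTICALLY from the skeleton (its §2′, L269–L280); the
forms `ξ₁₃`, `ξ₂₄`, `u₁ … u₄`, `mixedForm` are imported from `Tier4/Line4/MixedTransfer.lean` (t4-plan-4).

HOW.  (1) the coordinate projection commutes with the Hecke translate, so `u_j = T_{h_j} (a_{i_j})_σ`; (2) on the ball
the gradient of `u_j` is the Hecke sum (typer-1's `heckeSum`) of the corner form `cornerField_{i_j,σ}` (typer-1's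
`grad_heckeTranslate`: the chain rule summed over the unitary representatives); (3) that Hecke sum is a `Γ′`-invariant
`1`-form on the ball (typer-1's `cornerField_isAutForm1` — `a_i ∘ act γ − a_i` is a continuous map of the connected ball
into the discrete lattice `Λ_i`, hence constant — and `pullField_act_heckeSum` — the coset-representative permutation);
(4) the pull-back of a mixed form is the mixed form of the pull-backs: `Jᵀ · (p conj qᵀ) · conj J = (Jᵀp) conj (Jᵀq)ᵀ`,
and the skeleton's Jacobian matrix is typer-1's where the map is differentiable (`fderiv_pi`).

Imports only Mathlib and landed Tier-4 modules.  HC_CM is NOT proved by anyone in this repository.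
-/

set_option autoImplicit false

noncomputable section

open Matrix MeasureTheory NumberField
open scoped ComplexConjugate ComplexOrder

namespace Summit.Ventures.HodgeRepro.Tier4.Line4

open Summit.Ventures.HodgeRepro.Tier4

/-! ## 1. The DEFINED objects of the `(1,1)`-side (byte-identical to the skeleton v0.2, §2′) -/

/-- The complex Jacobian matrix `J_{kl} = ∂g_k/∂z_l` of a map `g : ℂ² → ℂ²`. -/
def jacMat (g : (Fin 2 → ℂ) → (Fin 2 → ℂ)) (z : Fin 2 → ℂ) : Form11 :=
  Matrix.of fun k l => fderiv ℂ g z (Pi.single l 1) k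

/-- The pullback `g^*ξ` of a `(1,1)`-form under a holomorphic map: `(g^*ξ)(z) = J(z)ᵀ · ξ(g z) · conj J(z)`
(for `ξ = du ∧ conj dv`: `d(u ∘ g) = Jᵀ (du ∘ g)`). -/
def pull (g : (Fin 2 → ℂ) → (Fin 2 → ℂ)) (ξ : (Fin 2 → ℂ) → Form11) : (Fin 2 → ℂ) → Form11 :=
  fun z => (jacMat g z)ᵀ * ξ (g z) * (jacMat g z).map (starRingEnd ℂ)

variable {F E : Type} [Field F] [NumberField F] [IsGalois ℚ F] [IsCMField F]
  [Field E] [NumberField E] [IsGalois ℚ E] [IsCMField E] (d : TargetData F E)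

/-- `Γ′`-invariance of a `(1,1)`-form on the ball, for the ball action `act γ = actM (toBallMat τ₀ C γ)` of the datum. -/
def IsInvariant11 (Γ' : Set (Matrix (Fin 3) (Fin 3) E)) (ξ : (Fin 2 → ℂ) → Form11) : Prop :=
  ∀ γ ∈ Γ', ∀ z ∈ ball, pull (d.act γ) ξ z = ξ z

/-! ## 2. The skeleton's Jacobian matrix is typer-1's where the map is differentiable -/

/-- Where `g` is differentiable, the skeleton's `jacMat` (`(fderiv g z)(e_l)_k`) is typer-1's `Tier4.jacMat`
(`pd l g_k z`). -/
theorem jacMat_eq_of_differentiableAt {g : (Fin 2 → ℂ) → (Fin 2 → ℂ)} {z : Fin 2 → ℂ}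
    (hg : DifferentiableAt ℂ g z) : jacMat g z = Tier4.jacMat g z := by
  ext k l
  have hpi := fderiv_pi (𝕜 := ℂ) (φ := fun i w => g w i) (x := z) fun i => (differentiableAt_pi.1 hg) i
  simp only [jacMat, Tier4.jacMat, Matrix.of_apply, pd]
  change fderiv ℂ (fun w i => g w i) z (Pi.single l 1) k = _
  rw [hpi]
  rfl

/-! ## 3. The pull-back of a mixed form is the mixed form of the pull-backs -/

/-- `Jᵀ · mixedForm p q · conj J = mixedForm (Jᵀ p) (Jᵀ q)` for every `2 × 2` matrix `J`. -/
theorem transpose_mul_mixedForm_mul_conjMap (J : Matrix (Fin 2) (Fin 2) ℂ) (p q : Fin 2 → ℂ) :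
    Jᵀ * mixedForm p q * J.map (starRingEnd ℂ) = mixedForm (Jᵀ *ᵥ p) (Jᵀ *ᵥ q) := by
  ext k l
  simp only [mixedForm, Matrix.mul_apply, Matrix.of_apply, Matrix.transpose_apply, Matrix.map_apply, Matrix.mulVec,
    dotProduct, Fin.sum_univ_two, map_add, map_mul]
  ring

/-- For a map differentiable at `z`, the pull-back of the mixed form of two fields `G, G′` is the mixed form of their
pull-backs `pullField g G z`, `pullField g G′ z`. -/
theorem pull_mixedForm {g : (Fin 2 → ℂ) → (Fin 2 → ℂ)} {z : Fin 2 → ℂ} (hg : DifferentiableAt ℂ g z)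
    (G G' : (Fin 2 → ℂ) → (Fin 2 → ℂ)) :
    pull g (fun w => mixedForm (G w) (G' w)) z = mixedForm (pullField g G z) (pullField g G' z) := by
  simp only [pull, pullField]
  rw [jacMat_eq_of_differentiableAt hg, transpose_mul_mixedForm_mul_conjMap]

/-! ## 4. The coordinates of a Hecke translate, their gradients, and the invariance of the gradient field -/

omit [NumberField E] [IsGalois ℚ E] [IsCMField E] in
/-- The coordinate projection commutes with the Hecke translate: `(T_h a)_σ = T_h (a_σ)`. -/
theorem comp_heckeTranslate {K : Type} [Field K] (T : Finset (K →+* ℂ)) (σ : K →+* ℂ) (hσ : σ ∈ T)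
    (τ₀ : E →+* ℂ) (C : Matrix (Fin 3) (Fin 3) ℂ) (h : HeckeElement E) (a : (Fin 2 → ℂ) → (↥T → ℂ)) :
    comp T σ hσ (heckeTranslate τ₀ C h a) = heckeTranslate τ₀ C h (comp T σ hσ a) := by
  funext z
  obtain ⟨ts⟩ := h
  induction ts with
  | nil => simp [comp, heckeTranslate]
  | cons t ts ih =>
    simp only [comp, heckeTranslate, List.map_cons, List.sum_cons, Pi.add_apply, Pi.smul_apply,
      Finset.sum_apply] at ih ⊢
    rw [ih]

/-- Two fields agreeing on the ball have the same Hecke sum at a point of the ball (all representatives unitary). -/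
theorem heckeSum_congr_of_eqOn_ball (ts : List (ℤ × Finset (Matrix (Fin 3) (Fin 3) E)))
    (hts : ∀ t ∈ ts, ∀ r ∈ t.2, IsUnitaryOf (conjE E) d.H r) {G G' : (Fin 2 → ℂ) → (Fin 2 → ℂ)}
    (hGG' : ∀ w ∈ ball, G w = G' w) {z : Fin 2 → ℂ} (hz : z ∈ ball) :
    d.heckeSum ⟨ts⟩ G z = d.heckeSum ⟨ts⟩ G' z := by
  induction ts with
  | nil => simp [TargetData.heckeSum]
  | cons t ts ih =>
    rw [d.heckeSum_cons, d.heckeSum_cons, ih fun t' ht' => hts t' (List.mem_cons_of_mem _ ht')]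
    congr 2
    refine Finset.sum_congr rfl fun r hr => ?_
    simp only [pullField]
    rw [hGG' _ (d.act_mem_ball_of_unitary (hts t List.mem_cons_self r hr) hz)]

/-- **The gradient of the coordinate of a Hecke translate is the Hecke sum of the corner form** on the ball. -/
theorem grad_comp_lift {Γ' : Set (Matrix (Fin 3) (Fin 3) E)} (hΓ' : Γ' ⊆ d.Γ) (i : Fin 4) (σ : F →+* ℂ)
    (hσ : σ ∈ d.T i) {h : HeckeElement E} (hh : h.IsFor (conjE E) d.H Γ') {z : Fin 2 → ℂ} (hz : z ∈ ball) :
    Tier4.grad (comp (d.T i) σ hσ (d.lift h i)) z = d.heckeSum h (d.cornerField i σ hσ) z := by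
  have hunit : ∀ t ∈ h.terms, ∀ r ∈ t.2, IsUnitaryOf (conjE E) d.H r :=
    fun t ht r hr => d.isUnitaryOf_of_mem_reps hΓ' hh ht hr
  rw [TargetData.lift, comp_heckeTranslate, show comp (d.T i) σ hσ (d.a i) = d.coord i σ hσ from rfl,
    d.grad_heckeTranslate (d.differentiableOn_coord i σ hσ) h hunit hz]
  obtain ⟨ts⟩ := h
  exact heckeSum_congr_of_eqOn_ball d ts hunit (fun w hw => (d.cornerField_of_mem i σ hσ hw).symm) hz

/-- **The gradient field of the coordinate of a Hecke translate is `Γ′`-invariant on the ball.** -/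
theorem pullField_act_heckeSum_cornerField {Γ' : Set (Matrix (Fin 3) (Fin 3) E)} (hΓ' : d.IsLevel Γ') (i : Fin 4)
    (σ : F →+* ℂ) (hσ : σ ∈ d.T i) {h : HeckeElement E} (hh : h.IsFor (conjE E) d.H Γ')
    {γ : Matrix (Fin 3) (Fin 3) E} (hγ : γ ∈ Γ') {z : Fin 2 → ℂ} (hz : z ∈ ball) :
    pullField (d.act γ) (d.heckeSum h (d.cornerField i σ hσ)) z = d.heckeSum h (d.cornerField i σ hσ) z := by
  obtain ⟨ts⟩ := h
  exact d.pullField_act_heckeSum hΓ'.1 ts hh (d.cornerField_isAutForm1 i σ hσ hΓ'.2) hγ hz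

/-! ## 5. The invariance of a mixed form built from two translated coordinates -/

/-- The mixed form `d(T_h a_i)_σ ∧ conj d(T_{h'} a_{i'})_{σ'}` is `Γ′`-invariant for `h, h'` of level `Γ′`. -/
theorem isInvariant11_mixedForm_grad {Γ' : Set (Matrix (Fin 3) (Fin 3) E)} (hΓ' : d.IsLevel Γ')
    (i i' : Fin 4) (σ σ' : F →+* ℂ) (hσ : σ ∈ d.T i) (hσ' : σ' ∈ d.T i') {h h' : HeckeElement E}
    (hh : h.IsFor (conjE E) d.H Γ') (hh' : h'.IsFor (conjE E) d.H Γ') :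
    IsInvariant11 d Γ' (fun z => mixedForm (grad (comp (d.T i) σ hσ (d.lift h i)) z)
      (grad (comp (d.T i') σ' hσ' (d.lift h' i')) z)) := by
  intro γ hγ z hz
  have hγΓ : γ ∈ d.Γ := hΓ'.2 hγ
  have hzγ : d.act γ z ∈ ball := d.act_mem_ball hγΓ hz
  have hG : ∀ w ∈ ball, grad (comp (d.T i) σ hσ (d.lift h i)) w = d.heckeSum h (d.cornerField i σ hσ) w :=
    fun w hw => grad_comp_lift d hΓ'.2 i σ hσ hh hw
  have hG' : ∀ w ∈ ball, grad (comp (d.T i') σ' hσ' (d.lift h' i')) w = d.heckeSum h' (d.cornerField i' σ' hσ') w :=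
    fun w hw => grad_comp_lift d hΓ'.2 i' σ' hσ' hh' hw
  have hfun : (fun w => mixedForm (grad (comp (d.T i) σ hσ (d.lift h i)) w)
      (grad (comp (d.T i') σ' hσ' (d.lift h' i')) w)) (d.act γ z) =
      mixedForm (d.heckeSum h (d.cornerField i σ hσ) (d.act γ z))
        (d.heckeSum h' (d.cornerField i' σ' hσ') (d.act γ z)) := by
    simp only [hG _ hzγ, hG' _ hzγ]
  simp only [pull] at hfun ⊢
  rw [hfun, jacMat_eq_of_differentiableAt (d.differentiableAt_act hγΓ hz), transpose_mul_mixedForm_mul_conjMap]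
  change mixedForm (pullField (d.act γ) (d.heckeSum h (d.cornerField i σ hσ)) z)
    (pullField (d.act γ) (d.heckeSum h' (d.cornerField i' σ' hσ')) z) = _
  rw [pullField_act_heckeSum_cornerField d hΓ' i σ hσ hh hγ hz,
    pullField_act_heckeSum_cornerField d hΓ' i' σ' hσ' hh' hγ hz, hG _ hz, hG' _ hz]

/-! ## 6. L4.1 -/

/-- **L4.1 `mixed_invariant`** (the registered signature of the skeleton v0.2, L313–L315) — the mixed forms
`ξ₁₃(h) = du₁ ∧ conj du₃` and `ξ₂₄(h) = du₂ ∧ conj du₄` are `Γ′`-invariant for every level `Γ′` and every `h` of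
level `Γ′`. -/
theorem mixed_invariant (Γ' : Set (Matrix (Fin 3) (Fin 3) E)) (hΓ' : d.IsLevel Γ') (h : Fin 4 → HeckeElement E)
    (hh : d.IsHeckeFor Γ' h) :
    IsInvariant11 d Γ' (ξ₁₃ d h) ∧ IsInvariant11 d Γ' (ξ₂₄ d h) :=
  ⟨isInvariant11_mixedForm_grad d hΓ' d.i₁ d.i₃ d.s (conjEmb d.s) d.hs₁ d.hs₃ (hh d.i₁) (hh d.i₃),
    isInvariant11_mixedForm_grad d hΓ' d.i₂ d.i₄ d.s (conjEmb d.s) d.hs₂ d.hs₄ (hh d.i₂) (hh d.i₄)⟩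

end Summit.Ventures.HodgeRepro.Tier4.Line4

end

#print axioms Summit.Ventures.HodgeRepro.Tier4.Line4.mixed_invariant
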